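import Literature.AlgebraicGeometry.HodgeTheory.AbelianVarietyQuotientIsotypicSupport
import HarnessLib

/-!
# The isotypic support of an image, of a sum of abelian subvarieties, and of the image of an endomorphism
# (Mumford §19 Thm. 1, Cor. 2; Lange–Rodríguez §2.9; Silverberg–Zarhin 2015 §3)

Layer `Literature/AlgebraicGeometry/HodgeTheory`; theorems only (no `def`, no instance, no named fact; net debt 0).  Setting of
`HodgeTheory/AbelianVarietySubvarietyIsotypicSupport`: a `Hom`-orthogonal system of abelian subvarieties `i_q : Y_q ↪ X` whose
addition map `desc i` is an isogeny with quasi-inverse `v` (`desc i ≫ v = m • 𝟙`, `m ≠ 0`), the central projectors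
`u_q = (v ≫ π_q) ≫ i_q`, and — over a PERFECT field — the isotypic components `Y_q ∼ B_q^{n_q+1}` of `X`.  For a homomorphism
`φ : W → X` the image `im φ ↪ X` is an abelian subvariety (`Motives/AbelianVarietyImage`); its `q`-th isotypic piece vanishes
iff `φ ≫ u_q = 0`, i.e. iff the `q`-th COORDINATE `φ ≫ v ≫ π_q : W → Y_q` of `φ` vanishes.  Applied to `φ = desc (j_l)` this
computes the support of a SUM `Σ_l Z_l` of abelian subvarieties (the union of the supports), and applied to an endomorphism
`α ∈ End X` — which commutes with the `u_q` — the support of `α(X)` (the `q` with non-zero block `i_q ≫ α`).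

THE PRINT.  Mumford, *Abelian Varieties* §19 Thm. 1 (p. 173: images and sums of abelian subvarieties in the proof of complete
reducibility) and Cor. 2 (p. 174: `End⁰(X) = ⊕_i M_{n_i}(D_i)`, an endomorphism acts blockwise on the isotypic components);
Lange–Rodríguez 2022 §2.9 (PDF p. 44: «Any sum `Σ_j A^{e_{i_j}}` is called an isotypical abelian subvariety … `A_W :=
Σ_{n_i > 0} A^{e_i}`»); Silverberg–Zarhin 2015 (held `paper:arxiv-1409.0592`) proof of Lemma 3.3 (p. 5) and p. 9 («if `X'`
is an `L`-isotypic component of `X`, let `Y' = f(X')`»).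

Results (namespace `Literature.AlgebraicGeometry.HodgeTheory.AbelianVariety`):
* §0 (any field, generic) `imageι_comp_eq_zero_iff` (`(im φ ↪ X) ≫ g = 0 ⟺ φ ≫ g = 0`), `biprod_desc_comp_eq_zero_iff`,
  `biproduct_desc_comp_eq_zero_iff`, **`forall_hom_image_eq_zero_of_forall_hom_source_eq_zero`** (`Hom(B, W) = 0 ⟹
  Hom(B, im φ) = 0` for simple `B` over a perfect field: the support of an image is contained in that of the source),
  `forall_hom_image_eq_zero_of_forall_hom_target_eq_zero`;
* §1 (any field) `imageι_comp_isotypicProjector_eq_zero_iff` (`(im φ)_q = 0 ⟺ φ ≫ v ≫ π_q = 0`),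
  `imageι_biproduct_desc_comp_isotypicProjector_eq_zero_iff` (pieces of a sum `Σ_l Z_l`),
  **`isotypicProjector_comp_eq_zero_iff_component_comp_eq_zero`** (`α ≫ u_q = 0 ⟺ i_q ≫ α = 0` for `α ∈ End X`),
  `imageι_endo_comp_isotypicProjector_eq_zero_iff` (`α(X)_q = 0 ⟺ i_q ≫ α = 0`);
* §2 (perfect field) **`forall_hom_simple_image_eq_zero_iff`** (`Hom(B_q, im φ) = 0 ⟺ φ ≫ v ≫ π_q = 0`),
  **`forall_hom_simple_image_biprod_desc_eq_zero_iff`** ∕ `…_biproduct_desc_…` (support of a sum = union of the supports),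
  **`forall_hom_simple_image_endo_eq_zero_iff`** (`Hom(B_q, α(X)) = 0 ⟺ i_q ≫ α = 0`).

## References
* [MumfordAV1970] D. Mumford, *Abelian Varieties* (1970), §19 Thm. 1, Remark p. 169, Cor. 1–2 (pp. 169–174).
* [LangeRodriguez2022] H. Lange, R. E. Rodríguez, *Decomposition of Jacobians by Prym Varieties*, LNM 2310 (2022), §2.9
  Thm. 2.9.1 and the paragraph following it (PDF pp. 43–44).
* [SilverbergZarhin2015] A. Silverberg, Yu. G. Zarhin, *Isogenies of abelian varieties over finite fields*, Des. Codes
  Cryptogr. 77 (2015) (arXiv:1409.0592), Lemma 3.1, Lemma 3.3 and its proof (p. 5), p. 9.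
* [Milne1986AbelianVarieties] J. S. Milne, *Abelian Varieties*, in Cornell–Silverman, *Arithmetic Geometry* (1986), §12
  Prop. 12.1 and p. 122 (PDF p. 189).
* [GortzWedhorn2020] U. Görtz, T. Wedhorn, *Algebraic Geometry I: Schemes*, 2nd ed. (2020), Prop. 4.32, Remark 10.32.
-/

noncomputable section

universe u

open CategoryTheory CategoryTheory.Limits

namespace Literature.AlgebraicGeometry.HodgeTheory

namespace AbelianVariety

open _root_.AlgebraicGeometry
open Literature.AlgebraicGeometry.Motives Literature.AlgebraicGeometry.Motives.AbelianVariety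

variable {K : Type u} [Field K]

/-! ## §0 Generic: images, sums, and `Hom(B, –)` for simple `B` -/

section Generic

variable {W X T : Motives.AbelianVariety K}

/-- `(im φ ↪ X) ≫ g = 0 ⟺ φ ≫ g = 0` (`W ↠ im φ` is an epimorphism). [cite: MumfordAV1970, §19 Thm. 1 (p. 173)]
[cite: GortzWedhorn2020, Prop. 4.32 (PDF p. 137)] -/
theorem imageι_comp_eq_zero_iff (φ : W ⟶ X) (g : X ⟶ T) : imageι φ ≫ g = 0 ↔ φ ≫ g = 0 := by
  haveI := epi_of_surjective_toSchemeHom (toImage φ)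
  rw [← cancel_epi (toImage φ), ← Category.assoc, toImage_imageι, comp_zero]

/-- `desc j j' ≫ g = 0 ⟺ j ≫ g = 0 ∧ j' ≫ g = 0`. [cite: MumfordAV1970, §19 Thm. 1 (p. 173)] -/
theorem biprod_desc_comp_eq_zero_iff {Z Z' : Motives.AbelianVariety K} (j : Z ⟶ X) (j' : Z' ⟶ X) (g : X ⟶ T) :
    biprod.desc j j' ≫ g = 0 ↔ j ≫ g = 0 ∧ j' ≫ g = 0 := by
  refine ⟨fun h ↦ ⟨?_, ?_⟩, fun ⟨h, h'⟩ ↦ biprod.hom_ext' _ _ ?_ ?_⟩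
  · rw [← biprod.inl_desc j j', Category.assoc, h, comp_zero]
  · rw [← biprod.inr_desc j j', Category.assoc, h, comp_zero]
  · rw [biprod.inl_desc_assoc, h, comp_zero]
  · rw [biprod.inr_desc_assoc, h', comp_zero]

/-- `desc (j_l) ≫ g = 0 ⟺ j_l ≫ g = 0` for every `l`. [cite: MumfordAV1970, §19 Thm. 1 (p. 173)] -/
theorem biproduct_desc_comp_eq_zero_iff {L : Type} [Fintype L] {Z : L → Motives.AbelianVariety K} (j : ∀ l, Z l ⟶ X)
    (g : X ⟶ T) : biproduct.desc j ≫ g = 0 ↔ ∀ l, j l ≫ g = 0 := by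
  classical
  refine ⟨fun h l ↦ ?_, fun h ↦ biproduct.hom_ext' _ _ fun l ↦ by rw [biproduct.ι_desc_assoc, h l, comp_zero]⟩
  rw [← biproduct.ι_desc j l, Category.assoc, h, comp_zero]

/-- **The support of an image is contained in the support of the source**: for a simple `B` over a perfect field and any
`φ : W → X`, `Hom(B, W) = 0 ⟹ Hom(B, im φ) = 0` (a non-zero `B → im φ` gives a non-zero `im φ → B`, hence a non-zero
`W ↠ im φ → B`, hence a non-zero `B → W`). [cite: MumfordAV1970, §19 Thm. 1 and Cor. 1 (p. 173)]
[cite: SilverbergZarhin2015, Lemma 3.1 (ii) ⟺ (iii) (p. 5)] -/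
theorem forall_hom_image_eq_zero_of_forall_hom_source_eq_zero [PerfectField K] {B : Motives.AbelianVariety K}
    (hB : B.IsSimple) (φ : W ⟶ X) (h : ∀ f : B ⟶ W, f = 0) : ∀ f : B ⟶ image φ, f = 0 := by
  by_contra hne
  push Not at hne
  obtain ⟨g, hg⟩ := hB.exists_ne_zero_hom_comm.1 hne
  haveI := epi_of_surjective_toSchemeHom (toImage φ)
  have hg' : toImage φ ≫ g ≠ 0 := fun h0 ↦ hg (by rw [← cancel_epi (toImage φ), h0, comp_zero])
  obtain ⟨f, hf⟩ := hB.exists_ne_zero_hom_comm.2 ⟨toImage φ ≫ g, hg'⟩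
  exact hf (h f)

/-- The support of an image is contained in the support of the target: `Hom(B, X) = 0 ⟹ Hom(B, im φ) = 0` (`im φ ↪ X` is a
monomorphism). [cite: MumfordAV1970, §19 Thm. 1 (p. 173)] -/
theorem forall_hom_image_eq_zero_of_forall_hom_target_eq_zero {B : Motives.AbelianVariety K} (φ : W ⟶ X)
    (h : ∀ f : B ⟶ X, f = 0) : ∀ f : B ⟶ image φ, f = 0 := fun f ↦ by
  haveI := mono_of_isClosedImmersion_toSchemeHom (imageι φ)
  rw [← cancel_mono (imageι φ), zero_comp]
  exact h _

end Generic

/-! ## §1 Pieces of images, of sums and of endomorphism images (any field) -/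

section AnyField

variable {Q : Type} [Fintype Q] {X W : Motives.AbelianVariety K} {Y : Q → Motives.AbelianVariety K} (i : ∀ q, Y q ⟶ X)
  {v : X ⟶ ⨁ Y} {m : ℕ}

/-- **`(im φ)_q = 0 ⟺ φ ≫ v ≫ π_q = 0`**: the `q`-th isotypic piece of the image of `φ : W → X` vanishes iff the `q`-th
coordinate of `φ` does. [cite: MumfordAV1970, §19 Thm. 1 and Cor. 2 (pp. 173–174)] [cite: SilverbergZarhin2015, p. 9 («Y' = f(X')»)] -/
theorem imageι_comp_isotypicProjector_eq_zero_iff (hi : ∀ q, IsClosedImmersion (Hom.toSchemeHom (i q))) (φ : W ⟶ X)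
    (q : Q) : imageι φ ≫ (v ≫ biproduct.π Y q) ≫ i q = 0 ↔ φ ≫ v ≫ biproduct.π Y q = 0 := by
  rw [imageι_comp_eq_zero_iff, comp_isotypicProjector_eq_zero_iff_comp_corestriction_eq_zero i φ hi q]

/-- **Pieces of a sum of abelian subvarieties**: for `j_l : Z_l → X`, the `q`-th piece of `Σ_l Z_l = im(desc j)` vanishes
iff every `j_l ≫ u_q` does. [cite: LangeRodriguez2022, §2.9 (PDF p. 44)] [cite: MumfordAV1970, §19 Thm. 1 (p. 173)] -/
theorem imageι_biproduct_desc_comp_isotypicProjector_eq_zero_iff {L : Type} [Fintype L] {Z : L → Motives.AbelianVariety K}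
    (j : ∀ l, Z l ⟶ X) (q : Q) :
    imageι (biproduct.desc j) ≫ (v ≫ biproduct.π Y q) ≫ i q = 0 ↔ ∀ l, j l ≫ (v ≫ biproduct.π Y q) ≫ i q = 0 := by
  rw [imageι_comp_eq_zero_iff, biproduct_desc_comp_eq_zero_iff]

/-- **`α ≫ u_q = 0 ⟺ i_q ≫ α = 0` for an endomorphism `α ∈ End X`**: `α` commutes with the central projector `u_q`, and
`u_q ≫ α = (v ≫ π_q) ≫ (i_q ≫ α)` with `v ≫ π_q` an epimorphism. [cite: MumfordAV1970, §19 Cor. 2 of Thm. 1 (p. 174)]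
[cite: LangeRodriguez2022, §2.9 Thm. 2.9.1 (PDF p. 43)] -/
theorem isotypicProjector_comp_eq_zero_iff_component_comp_eq_zero (hi : ∀ q, IsClosedImmersion (Hom.toSchemeHom (i q)))
    (hdesc : IsIsogeny (biproduct.desc i)) (hdv : biproduct.desc i ≫ v = m • 𝟙 (⨁ Y))
    (horth : ∀ q q', q ≠ q' → ∀ f : Y q ⟶ Y q', f = 0) (hm : m ≠ 0) (α : X ⟶ X) (q : Q) :
    α ≫ (v ≫ biproduct.π Y q) ≫ i q = 0 ↔ i q ≫ α = 0 := by
  rw [isotypicProjector_comm i hi hdesc hdv horth α q, isotypicProjector_comp_eq_zero_iff i α hdv hm q]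

/-- **`α(X)_q = 0 ⟺ i_q ≫ α = 0`**: the `q`-th piece of the image of an endomorphism vanishes iff its `q`-th block does.
[cite: MumfordAV1970, §19 Cor. 2 of Thm. 1 (p. 174)] [cite: LangeRodriguez2022, §2.9 (PDF pp. 43–44)] -/
theorem imageι_endo_comp_isotypicProjector_eq_zero_iff (hi : ∀ q, IsClosedImmersion (Hom.toSchemeHom (i q)))
    (hdesc : IsIsogeny (biproduct.desc i)) (hdv : biproduct.desc i ≫ v = m • 𝟙 (⨁ Y))
    (horth : ∀ q q', q ≠ q' → ∀ f : Y q ⟶ Y q', f = 0) (hm : m ≠ 0) (α : X ⟶ X) (q : Q) :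
    imageι α ≫ (v ≫ biproduct.π Y q) ≫ i q = 0 ↔ i q ≫ α = 0 := by
  rw [imageι_comp_eq_zero_iff, isotypicProjector_comp_eq_zero_iff_component_comp_eq_zero i hi hdesc hdv horth hm α q]

end AnyField

/-! ## §2 Over a perfect field: supports of images, sums and endomorphism images -/

section Perfect

variable [PerfectField K] {Q : Type} [Fintype Q] {B : Q → Motives.AbelianVariety K} {n : Q → ℕ}
  {X W : Motives.AbelianVariety K} {Y : Q → Motives.AbelianVariety K}

/-- **`Hom(B_q, im φ) = 0 ⟺ φ ≫ v ≫ π_q = 0`**: the support of the image of `φ : W → X` is the set of types `q` at which the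
coordinate `φ ≫ v ≫ π_q : W → Y_q` is non-zero (perfect field; isotypic components `Y_q ∼ B_q^{n_q+1}` of `X`).
[cite: MumfordAV1970, §19 Thm. 1 and Cor. 1–2 (pp. 173–174)] [cite: SilverbergZarhin2015, proof of Lemma 3.3 (p. 5) and p. 9] -/
theorem forall_hom_simple_image_eq_zero_iff (hB : ∀ q, (B q).IsSimple) (hB0 : ∀ q, 0 < (B q).dim)
    (hni : ∀ q q', q ≠ q' → ¬ IsIsogenous (B q) (B q')) (hY : ∀ q, IsIsogenous (Y q) (⨁ fun _ : Fin (n q + 1) ↦ B q))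
    (i : ∀ q, Y q ⟶ X) (hi : ∀ q, IsClosedImmersion (Hom.toSchemeHom (i q))) (hdesc : IsIsogeny (biproduct.desc i))
    {v : X ⟶ ⨁ Y} {m : ℕ} (hdv : biproduct.desc i ≫ v = m • 𝟙 (⨁ Y)) (hm : m ≠ 0) (φ : W ⟶ X) (q : Q) :
    (∀ f : B q ⟶ image φ, f = 0) ↔ φ ≫ v ≫ biproduct.π Y q = 0 := by
  rw [← comp_isotypicProjector_eq_zero_iff_forall_hom_simple_eq_zero hB hB0 hni hY i hi hdesc hdv hm (imageι φ) q,
    imageι_comp_isotypicProjector_eq_zero_iff i hi φ q]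

/-- **The support of a sum of two abelian subvarieties is the union of their supports**: for closed immersions `j : Z ↪ X`,
`j' : Z' ↪ X`, `Hom(B_q, Z + Z') = 0 ⟺ Hom(B_q, Z) = 0 ∧ Hom(B_q, Z') = 0`, where `Z + Z' = im(desc j j')`.
[cite: LangeRodriguez2022, §2.9 (PDF p. 44)] [cite: MumfordAV1970, §19 Thm. 1 (p. 173)] -/
theorem forall_hom_simple_image_biprod_desc_eq_zero_iff (hB : ∀ q, (B q).IsSimple) (hB0 : ∀ q, 0 < (B q).dim)
    (hni : ∀ q q', q ≠ q' → ¬ IsIsogenous (B q) (B q')) (hY : ∀ q, IsIsogenous (Y q) (⨁ fun _ : Fin (n q + 1) ↦ B q))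
    (i : ∀ q, Y q ⟶ X) (hi : ∀ q, IsClosedImmersion (Hom.toSchemeHom (i q))) (hdesc : IsIsogeny (biproduct.desc i))
    {Z Z' : Motives.AbelianVariety K} (j : Z ⟶ X) [IsClosedImmersion (Hom.toSchemeHom j)] (j' : Z' ⟶ X)
    [IsClosedImmersion (Hom.toSchemeHom j')] (q : Q) :
    (∀ f : B q ⟶ image (biprod.desc j j'), f = 0) ↔ (∀ f : B q ⟶ Z, f = 0) ∧ ∀ f : B q ⟶ Z', f = 0 := by
  obtain ⟨v, m, hm, hdv, -⟩ := IsIsogeny.exists_nsmul_inverse_holds hdesc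
  rw [← comp_isotypicProjector_eq_zero_iff_forall_hom_simple_eq_zero hB hB0 hni hY i hi hdesc hdv hm.ne'
      (imageι (biprod.desc j j')) q, imageι_comp_eq_zero_iff, biprod_desc_comp_eq_zero_iff,
    comp_isotypicProjector_eq_zero_iff_forall_hom_simple_eq_zero hB hB0 hni hY i hi hdesc hdv hm.ne' j q,
    comp_isotypicProjector_eq_zero_iff_forall_hom_simple_eq_zero hB hB0 hni hY i hi hdesc hdv hm.ne' j' q]

/-- **The support of a finite sum `Σ_l Z_l` of abelian subvarieties is the union of the supports.**
[cite: LangeRodriguez2022, §2.9 (PDF p. 44: `A_W := Σ_{n_i > 0} A^{e_i}`)] [cite: MumfordAV1970, §19 Thm. 1 (p. 173)] -/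
theorem forall_hom_simple_image_biproduct_desc_eq_zero_iff (hB : ∀ q, (B q).IsSimple) (hB0 : ∀ q, 0 < (B q).dim)
    (hni : ∀ q q', q ≠ q' → ¬ IsIsogenous (B q) (B q')) (hY : ∀ q, IsIsogenous (Y q) (⨁ fun _ : Fin (n q + 1) ↦ B q))
    (i : ∀ q, Y q ⟶ X) (hi : ∀ q, IsClosedImmersion (Hom.toSchemeHom (i q))) (hdesc : IsIsogeny (biproduct.desc i))
    {L : Type} [Fintype L] {Z : L → Motives.AbelianVariety K} (j : ∀ l, Z l ⟶ X)
    (hj : ∀ l, IsClosedImmersion (Hom.toSchemeHom (j l))) (q : Q) :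
    (∀ f : B q ⟶ image (biproduct.desc j), f = 0) ↔ ∀ l, ∀ f : B q ⟶ Z l, f = 0 := by
  obtain ⟨v, m, hm, hdv, -⟩ := IsIsogeny.exists_nsmul_inverse_holds hdesc
  rw [← comp_isotypicProjector_eq_zero_iff_forall_hom_simple_eq_zero hB hB0 hni hY i hi hdesc hdv hm.ne'
      (imageι (biproduct.desc j)) q, imageι_comp_eq_zero_iff, biproduct_desc_comp_eq_zero_iff]
  refine forall_congr' fun l ↦ ?_
  haveI := hj l
  exact comp_isotypicProjector_eq_zero_iff_forall_hom_simple_eq_zero hB hB0 hni hY i hi hdesc hdv hm.ne' (j l) q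

/-- **The support of the image `α(X)` of an endomorphism is the set of types with non-zero block**: `Hom(B_q, im α) = 0 ⟺
i_q ≫ α = 0` (perfect field). [cite: MumfordAV1970, §19 Cor. 2 of Thm. 1 (p. 174: `End⁰ X = ⊕ M_{n_i}(D_i)`)]
[cite: LangeRodriguez2022, §2.9 Thm. 2.9.1 (PDF pp. 43–44)] -/
theorem forall_hom_simple_image_endo_eq_zero_iff (hB : ∀ q, (B q).IsSimple) (hB0 : ∀ q, 0 < (B q).dim)
    (hni : ∀ q q', q ≠ q' → ¬ IsIsogenous (B q) (B q')) (hY : ∀ q, IsIsogenous (Y q) (⨁ fun _ : Fin (n q + 1) ↦ B q))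
    (i : ∀ q, Y q ⟶ X) (hi : ∀ q, IsClosedImmersion (Hom.toSchemeHom (i q))) (hdesc : IsIsogeny (biproduct.desc i))
    (α : X ⟶ X) (q : Q) : (∀ f : B q ⟶ image α, f = 0) ↔ i q ≫ α = 0 := by
  have horth : ∀ q q', q ≠ q' → ∀ f : Y q ⟶ Y q', f = 0 := fun q q' hqq' f ↦
    hom_eq_zero_of_isIsogenous_biproduct_const_of_ne hB hB0 hni hqq' (hY q) (hY q') f
  obtain ⟨v, m, hm, hdv, -⟩ := IsIsogeny.exists_nsmul_inverse_holds hdesc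
  rw [← comp_isotypicProjector_eq_zero_iff_forall_hom_simple_eq_zero hB hB0 hni hY i hi hdesc hdv hm.ne' (imageι α) q,
    imageι_endo_comp_isotypicProjector_eq_zero_iff i hi hdesc hdv horth hm.ne' α q]

end Perfect

end AbelianVariety

end Literature.AlgebraicGeometry.HodgeTheory

end
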